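import Summits.AtomisticToContinuum.BoseEinsteinCondensation.Theses.BECStronglyRayleigh
import Summits.AtomisticToContinuum.BoseEinsteinCondensation.Theorems.InsertionFieldDelocalisation.Negative.Toolkit
import Summits.AtomisticToContinuum.BoseEinsteinCondensation.Theorems.InsertionFieldDelocalisation.Negative.Tightness
import Summits.AtomisticToContinuum.BoseEinsteinCondensation.Theorems.InsertionFieldDelocalisation.Negative.LoadBearing
import Summits.AtomisticToContinuum.BoseEinsteinCondensation.Theorems.BECStronglyRayleighGroundStateStability
import HarnessLib

/-!
# Line `mobile-trap-dirichlet-eigenfunction` — skeleton for crux `BECStronglyRayleigh.InsertionFieldDelocalisation`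
# (stmt-AtomisticToContinuum-9673), DEF-FREE RESHAPE by the line lead (prover-line-stmt-AtomisticToContinuum-9673-0, 2026-08-16)

This is the crux-plan skeleton `Lines/mobile-trap-dirichlet-eigenfunction.lean` (planner, commit 8a42abad7307; six stubs:
convexity, excessBound, embedding, voidTail, annealedGain, transfer; composition `InsertionFieldDelocalisation_of`) with ONE
change of form and none of content: every registered stub signature is spelled out over IMPORTABLE declarations only
(`lowestEnergyInSector`, `xyTorus`, `spinZSector`, `torusGraph`, `SimpleGraph.dist`, the landed `Negative.field` / `K1rhs`), so that
each stub can be landed as a stand-alone `Theorems/BECStronglyRayleighInsertionFieldDelocalisation<Stub>.lean` without first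
landing a reviewed `Defs` file (the planner's skeleton typed the stubs through the local defs `secE`, `trapRate`, `ins`, `amp`,
`ind`, `IsCruxGround`, `voidRadius`, `M3` and the six `Prop` names, none of which is importable). The named `Prop`s are kept below
as DOCUMENTATION (`def … : Prop`) and are proved equal to the spelled-out forms by `Iff.rfl`-style lemmas; the composition is
re-proved against the spelled-out forms. Mathematical content, stub list, hardest stub (`stub_annealedGain`) and the `Disproof.lean`
obligations are exactly as in the planner's file and line card `Lines/mobile-trap-dirichlet-eigenfunction.md` — read those for the
idea (insertion field = principal Dirichlet eigenfunction of one walker among N−1 mobile hard traps; convexity of sector energies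
pins the killing rate δ_N ≤ 12ν; K1 = annealed anti-localisation: void cost e^{−c₁νR³} beats void gain e^{c₂νR²}).

Conventions: occupied = spin up = `Fin`-index `0`; `1_S = fun z => if z ∈ S then 0 else 1`; sector of `k` bosons = magnetisation
`k − L³/2`; `E(k) := lowestEnergyInSector 1 (xyTorus 3 L 1) (k − L³/2)`; `r^T = Negative.field ψ T`; the one-particle insertion
field `u^T_x := [x ∉ T]·Re ψ(1_{T ∪ x})`; void radius `ρ_T(x) := ((T.image fun t => (torusGraph 3 L).dist x t).min.untopD 0)`;
`x/0 = 0` throughout.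
-/

noncomputable section

namespace Summit.AtomisticToContinuum.BoseEinsteinCondensation.Cruxes.InsertionFieldDelocalisation.MobileTrapDirichletEigenfunction

open scoped BigOperators
open Literature.MathematicalPhysics.QuantumLattice Literature.Probability.LatticeModels
open Summit.AtomisticToContinuum.BoseEinsteinCondensation.Theses.BECStronglyRayleigh
  (InsertionFieldDelocalisation GroundStateStability)
open Summit.AtomisticToContinuum.BoseEinsteinCondensation.Theorems.InsertionFieldDelocalisation.Negative
  (field K1lhs K1rhs K1Ineq InsertionFieldDelocalisationAt insertionFieldDelocalisation_iff
    sq_sum_sq_le_sum_mul_sum_cube field_nonneg field_eq_zero_of_mem)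

/-! ## Registered stubs (def-free signatures) -/

/-- STUB 1 · `stub_convexity` (L) — **convexity of the sector ground energies in the particle number**:
`2E(N) ≤ E(N+1) + E(N−1)` for `1 ≤ N`, `N + 1 ≤ L³`. Proof route (lead's limit-free plan): stability of `e^{−τH}𝟙`
(landed engine `stub_trotterClosure` ∘ `stub_eulerLimit` ∘ `stub_eulerGate`, `stub_siteFactor`), negative lattice condition with
constant one for real stable multi-affine polynomials (`Literature.Combinatorics.StablePolynomials.multiAffine_negLatticeCondition`),
sector bounds `e^{−τE(n)}ψ_n(S)/max ψ_n ≤ (e^{−τH}𝟙)(1_S) ≤ e^{−τE(n)}√C(V,n)` at finite `τ`, and `τ → ∞`. -/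
theorem stub_convexity :
    ∀ (L : ℕ) [NeZero L], 2 ≤ L → ∀ N : ℕ, 1 ≤ N → N + 1 ≤ L ^ 3 →
      2 * lowestEnergyInSector 1 (xyTorus 3 L 1) ((N : ℝ) - (L : ℝ) ^ 3 / 2) ≤
        lowestEnergyInSector 1 (xyTorus 3 L 1) (((N + 1 : ℕ) : ℝ) - (L : ℝ) ^ 3 / 2) +
          lowestEnergyInSector 1 (xyTorus 3 L 1) (((N - 1 : ℕ) : ℝ) - (L : ℝ) ^ 3 / 2) := by
  sorry

/-- STUB 2 · `stub_excessBound` (M) — convexity ⇒ the trapping rate is `O(ν)`: one constant `C` with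
`δ_N := E(N) − E(N−1) + 3 ≤ C·N/L³` for all `L ≥ 2`, `2 ≤ N ≤ L³/2` (telescoping `Nμ_N ≤ E(2N) − E(N)`, flat trial state
`E(2N) ≤ −3n(L³−n)/(L³−1)`, `E(N) ≥ −3N`; `C = 60` absorbs `L = 2`). -/
theorem stub_excessBound :
    (∀ (L : ℕ) [NeZero L], 2 ≤ L → ∀ N : ℕ, 1 ≤ N → N + 1 ≤ L ^ 3 →
      2 * lowestEnergyInSector 1 (xyTorus 3 L 1) ((N : ℝ) - (L : ℝ) ^ 3 / 2) ≤
        lowestEnergyInSector 1 (xyTorus 3 L 1) (((N + 1 : ℕ) : ℝ) - (L : ℝ) ^ 3 / 2) +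
          lowestEnergyInSector 1 (xyTorus 3 L 1) (((N - 1 : ℕ) : ℝ) - (L : ℝ) ^ 3 / 2)) →
    ∃ C : ℝ, ∀ (L : ℕ) [NeZero L], 2 ≤ L → ∀ N : ℕ, 2 ≤ N → 2 * N ≤ L ^ 3 →
      lowestEnergyInSector 1 (xyTorus 3 L 1) ((N : ℝ) - (L : ℝ) ^ 3 / 2) -
          lowestEnergyInSector 1 (xyTorus 3 L 1) (((N - 1 : ℕ) : ℝ) - (L : ℝ) ^ 3 / 2) + 3 ≤
        C * N / (L : ℝ) ^ 3 := by
  sorry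

/-- STUB 3 · `stub_embedding` (M) — **the two-body embedding of an eigenvector** (exact, all `T`, all `x`): for `Hψ = Eψ`,
`H = xyTorus 3 L 1`, the one-particle insertion field `u(T,x) = [x ∉ T]·Re ψ(1_{T∪x})` satisfies
`−½ Σ_{t∈T} Σ_{b∉T, b∼t} u(T−t+b, x) − ½ Σ_{y∼x} u(T,y) − E·u(T,x) = −[x ∈ T]·Σ_{y∼x} u(T,y)`. -/
theorem stub_embedding :
    ∀ (L : ℕ) [NeZero L] (E : ℝ) (ψ : TensorIndex (TorusSite 3 L) 2 → ℂ),
      (xyTorus 3 L 1).mulVec ψ = (E : ℂ) • ψ →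
      ∀ (T : Finset (TorusSite 3 L)) (x : TorusSite 3 L),
        -(1 / 2 : ℝ) * (∑ t ∈ T, ∑ b : TorusSite 3 L,
            if b ∉ T ∧ (torusGraph 3 L).Adj t b then
              (if x ∉ insert b (T.erase t) then
                (ψ (fun z => if z ∈ insert x (insert b (T.erase t)) then 0 else 1)).re else 0)
            else 0)
          - (1 / 2 : ℝ) * (∑ y : TorusSite 3 L, if (torusGraph 3 L).Adj x y then
              (if y ∉ T then (ψ (fun z => if z ∈ insert y T then 0 else 1)).re else 0) else 0)
          - E * (if x ∉ T then (ψ (fun z => if z ∈ insert x T then 0 else 1)).re else 0)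
        = -(if x ∈ T then ∑ y : TorusSite 3 L, (if (torusGraph 3 L).Adj x y then
              (if y ∉ T then (ψ (fun z => if z ∈ insert y T then 0 else 1)).re else 0) else 0)
            else 0) := by
  sorry

/-- STUB 4 · `stub_voidTail` (XL) — **void tail under the size-biased law**: there are `C₁` and `c₁ > 0` such that for every
admissible `(L, N, ψ)` and every `R`, `Σ_{(T,x) : ρ_T(x) > R} (r^T_x)² ≤ C₁ e^{−c₁ (N/L³) R³} Σ_{(T,x)} (r^T_x)²`. -/
theorem stub_voidTail :
    ∃ C₁ c₁ : ℝ, 0 < c₁ ∧ ∀ (L : ℕ) [NeZero L], 2 ≤ L → ∀ N : ℕ, 2 ≤ N → 2 * N ≤ L ^ 3 →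
      ∀ ψ : TensorIndex (TorusSite 3 L) 2 → ℂ,
        ψ ∈ spinZSector 1 ((N : ℝ) - (L : ℝ) ^ 3 / 2) → ψ ≠ 0 →
        (xyTorus 3 L 1).mulVec ψ =
          ((lowestEnergyInSector 1 (xyTorus 3 L 1) ((N : ℝ) - (L : ℝ) ^ 3 / 2) : ℝ) : ℂ) • ψ →
        (∀ σ, 0 ≤ (ψ σ).re ∧ (ψ σ).im = 0) → ∀ R : ℕ,
        (∑ T ∈ (Finset.univ : Finset (TorusSite 3 L)).powersetCard (N - 2), ∑ x : TorusSite 3 L,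
            if R < ((T.image fun t => (torusGraph 3 L).dist x t).min.untopD 0) then field ψ T x ^ 2 else 0)
          ≤ C₁ * Real.exp (-(c₁ * ((N : ℝ) / (L : ℝ) ^ 3) * (R : ℝ) ^ 3)) *
            ∑ T ∈ (Finset.univ : Finset (TorusSite 3 L)).powersetCard (N - 2), ∑ x : TorusSite 3 L,
              field ψ T x ^ 2 := by
  sorry

/-- STUB 5 · `stub_annealedGain` (XL; HARDEST, load-bearing; the lead's) — embedding ⇒ excess bound ⇒ **annealed gain**:
conditionally on the void radius `ρ_T(x) = R`, the size-biased mean of the normalised profile `L³ q_T(x)` is at most the survival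
gain `C₂ e^{c₂ (N/L³) R²}`. -/
theorem stub_annealedGain :
    (∀ (L : ℕ) [NeZero L] (E : ℝ) (ψ : TensorIndex (TorusSite 3 L) 2 → ℂ),
      (xyTorus 3 L 1).mulVec ψ = (E : ℂ) • ψ →
      ∀ (T : Finset (TorusSite 3 L)) (x : TorusSite 3 L),
        -(1 / 2 : ℝ) * (∑ t ∈ T, ∑ b : TorusSite 3 L,
            if b ∉ T ∧ (torusGraph 3 L).Adj t b then
              (if x ∉ insert b (T.erase t) then
                (ψ (fun z => if z ∈ insert x (insert b (T.erase t)) then 0 else 1)).re else 0)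
            else 0)
          - (1 / 2 : ℝ) * (∑ y : TorusSite 3 L, if (torusGraph 3 L).Adj x y then
              (if y ∉ T then (ψ (fun z => if z ∈ insert y T then 0 else 1)).re else 0) else 0)
          - E * (if x ∉ T then (ψ (fun z => if z ∈ insert x T then 0 else 1)).re else 0)
        = -(if x ∈ T then ∑ y : TorusSite 3 L, (if (torusGraph 3 L).Adj x y then
              (if y ∉ T then (ψ (fun z => if z ∈ insert y T then 0 else 1)).re else 0) else 0)
            else 0)) →
    (∃ C : ℝ, ∀ (L : ℕ) [NeZero L], 2 ≤ L → ∀ N : ℕ, 2 ≤ N → 2 * N ≤ L ^ 3 →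
      lowestEnergyInSector 1 (xyTorus 3 L 1) ((N : ℝ) - (L : ℝ) ^ 3 / 2) -
          lowestEnergyInSector 1 (xyTorus 3 L 1) (((N - 1 : ℕ) : ℝ) - (L : ℝ) ^ 3 / 2) + 3 ≤
        C * N / (L : ℝ) ^ 3) →
    ∃ C₂ c₂ : ℝ, ∀ (L : ℕ) [NeZero L], 2 ≤ L → ∀ N : ℕ, 2 ≤ N → 2 * N ≤ L ^ 3 →
      ∀ ψ : TensorIndex (TorusSite 3 L) 2 → ℂ,
        ψ ∈ spinZSector 1 ((N : ℝ) - (L : ℝ) ^ 3 / 2) → ψ ≠ 0 →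
        (xyTorus 3 L 1).mulVec ψ =
          ((lowestEnergyInSector 1 (xyTorus 3 L 1) ((N : ℝ) - (L : ℝ) ^ 3 / 2) : ℝ) : ℂ) • ψ →
        (∀ σ, 0 ≤ (ψ σ).re ∧ (ψ σ).im = 0) → ∀ R : ℕ,
        (∑ T ∈ (Finset.univ : Finset (TorusSite 3 L)).powersetCard (N - 2), ∑ x : TorusSite 3 L,
            if ((T.image fun t => (torusGraph 3 L).dist x t).min.untopD 0) = R then
              field ψ T x ^ 2 * ((L : ℝ) ^ 3 * field ψ T x / ∑ y : TorusSite 3 L, field ψ T y)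
            else 0)
          ≤ C₂ * Real.exp (c₂ * ((N : ℝ) / (L : ℝ) ^ 3) * (R : ℝ) ^ 2) *
            ∑ T ∈ (Finset.univ : Finset (TorusSite 3 L)).powersetCard (N - 2), ∑ x : TorusSite 3 L,
              if ((T.image fun t => (torusGraph 3 L).dist x t).min.untopD 0) = R then field ψ T x ^ 2 else 0 := by
  sorry

/-- STUB 6 · `stub_transfer` (M–L) — void tail ⇒ annealed gain ⇒ the crux in its size-biased third-moment form
`L³ Σ_T (Σ_x (r^T_x)³ / Σ_x r^T_x) ≤ M' Σ_T ‖r^T‖²` (shell disintegration + Abel summation, uniform in `ν ≤ ½` after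
`R = ν^{−1/3}s`). -/
theorem stub_transfer :
    (∃ C₁ c₁ : ℝ, 0 < c₁ ∧ ∀ (L : ℕ) [NeZero L], 2 ≤ L → ∀ N : ℕ, 2 ≤ N → 2 * N ≤ L ^ 3 →
      ∀ ψ : TensorIndex (TorusSite 3 L) 2 → ℂ,
        ψ ∈ spinZSector 1 ((N : ℝ) - (L : ℝ) ^ 3 / 2) → ψ ≠ 0 →
        (xyTorus 3 L 1).mulVec ψ =
          ((lowestEnergyInSector 1 (xyTorus 3 L 1) ((N : ℝ) - (L : ℝ) ^ 3 / 2) : ℝ) : ℂ) • ψ →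
        (∀ σ, 0 ≤ (ψ σ).re ∧ (ψ σ).im = 0) → ∀ R : ℕ,
        (∑ T ∈ (Finset.univ : Finset (TorusSite 3 L)).powersetCard (N - 2), ∑ x : TorusSite 3 L,
            if R < ((T.image fun t => (torusGraph 3 L).dist x t).min.untopD 0) then field ψ T x ^ 2 else 0)
          ≤ C₁ * Real.exp (-(c₁ * ((N : ℝ) / (L : ℝ) ^ 3) * (R : ℝ) ^ 3)) *
            ∑ T ∈ (Finset.univ : Finset (TorusSite 3 L)).powersetCard (N - 2), ∑ x : TorusSite 3 L,
              field ψ T x ^ 2) →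
    (∃ C₂ c₂ : ℝ, ∀ (L : ℕ) [NeZero L], 2 ≤ L → ∀ N : ℕ, 2 ≤ N → 2 * N ≤ L ^ 3 →
      ∀ ψ : TensorIndex (TorusSite 3 L) 2 → ℂ,
        ψ ∈ spinZSector 1 ((N : ℝ) - (L : ℝ) ^ 3 / 2) → ψ ≠ 0 →
        (xyTorus 3 L 1).mulVec ψ =
          ((lowestEnergyInSector 1 (xyTorus 3 L 1) ((N : ℝ) - (L : ℝ) ^ 3 / 2) : ℝ) : ℂ) • ψ →
        (∀ σ, 0 ≤ (ψ σ).re ∧ (ψ σ).im = 0) → ∀ R : ℕ,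
        (∑ T ∈ (Finset.univ : Finset (TorusSite 3 L)).powersetCard (N - 2), ∑ x : TorusSite 3 L,
            if ((T.image fun t => (torusGraph 3 L).dist x t).min.untopD 0) = R then
              field ψ T x ^ 2 * ((L : ℝ) ^ 3 * field ψ T x / ∑ y : TorusSite 3 L, field ψ T y)
            else 0)
          ≤ C₂ * Real.exp (c₂ * ((N : ℝ) / (L : ℝ) ^ 3) * (R : ℝ) ^ 2) *
            ∑ T ∈ (Finset.univ : Finset (TorusSite 3 L)).powersetCard (N - 2), ∑ x : TorusSite 3 L,
              if ((T.image fun t => (torusGraph 3 L).dist x t).min.untopD 0) = R then field ψ T x ^ 2 else 0) →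
    ∃ M' : ℝ, ∀ (L : ℕ) [NeZero L], 2 ≤ L → ∀ N : ℕ, 2 ≤ N → 2 * N ≤ L ^ 3 →
      ∀ ψ : TensorIndex (TorusSite 3 L) 2 → ℂ,
        ψ ∈ spinZSector 1 ((N : ℝ) - (L : ℝ) ^ 3 / 2) → ψ ≠ 0 →
        (xyTorus 3 L 1).mulVec ψ =
          ((lowestEnergyInSector 1 (xyTorus 3 L 1) ((N : ℝ) - (L : ℝ) ^ 3 / 2) : ℝ) : ℂ) • ψ →
        (∀ σ, 0 ≤ (ψ σ).re ∧ (ψ σ).im = 0) →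
        (L : ℝ) ^ 3 * ∑ T ∈ (Finset.univ : Finset (TorusSite 3 L)).powersetCard (N - 2),
            (∑ x, field ψ T x ^ 3) / (∑ x, field ψ T x)
          ≤ M' * ∑ T ∈ (Finset.univ : Finset (TorusSite 3 L)).powersetCard (N - 2), K1rhs (field ψ T) := by
  sorry

/-! ## Name-keyed aliases of the six stub statements (hypotheses of the composition) -/
namespace Registered

/-- Statement of `stub_convexity`. -/
abbrev stub_convexity : Prop :=
  ∀ (L : ℕ) [NeZero L], 2 ≤ L → ∀ N : ℕ, 1 ≤ N → N + 1 ≤ L ^ 3 →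
    2 * lowestEnergyInSector 1 (xyTorus 3 L 1) ((N : ℝ) - (L : ℝ) ^ 3 / 2) ≤
      lowestEnergyInSector 1 (xyTorus 3 L 1) (((N + 1 : ℕ) : ℝ) - (L : ℝ) ^ 3 / 2) +
        lowestEnergyInSector 1 (xyTorus 3 L 1) (((N - 1 : ℕ) : ℝ) - (L : ℝ) ^ 3 / 2)

/-- The excess bound (conclusion of `stub_excessBound`). -/
abbrev ExcessBound' : Prop :=
  ∃ C : ℝ, ∀ (L : ℕ) [NeZero L], 2 ≤ L → ∀ N : ℕ, 2 ≤ N → 2 * N ≤ L ^ 3 →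
    lowestEnergyInSector 1 (xyTorus 3 L 1) ((N : ℝ) - (L : ℝ) ^ 3 / 2) -
        lowestEnergyInSector 1 (xyTorus 3 L 1) (((N - 1 : ℕ) : ℝ) - (L : ℝ) ^ 3 / 2) + 3 ≤
      C * N / (L : ℝ) ^ 3

/-- Statement of `stub_excessBound`. -/
abbrev stub_excessBound : Prop := stub_convexity → ExcessBound'

/-- Statement of `stub_embedding` (the two-body embedding). -/
abbrev stub_embedding : Prop :=
  ∀ (L : ℕ) [NeZero L] (E : ℝ) (ψ : TensorIndex (TorusSite 3 L) 2 → ℂ),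
    (xyTorus 3 L 1).mulVec ψ = (E : ℂ) • ψ →
    ∀ (T : Finset (TorusSite 3 L)) (x : TorusSite 3 L),
      -(1 / 2 : ℝ) * (∑ t ∈ T, ∑ b : TorusSite 3 L,
          if b ∉ T ∧ (torusGraph 3 L).Adj t b then
            (if x ∉ insert b (T.erase t) then
              (ψ (fun z => if z ∈ insert x (insert b (T.erase t)) then 0 else 1)).re else 0)
          else 0)
        - (1 / 2 : ℝ) * (∑ y : TorusSite 3 L, if (torusGraph 3 L).Adj x y then
            (if y ∉ T then (ψ (fun z => if z ∈ insert y T then 0 else 1)).re else 0) else 0)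
        - E * (if x ∉ T then (ψ (fun z => if z ∈ insert x T then 0 else 1)).re else 0)
      = -(if x ∈ T then ∑ y : TorusSite 3 L, (if (torusGraph 3 L).Adj x y then
            (if y ∉ T then (ψ (fun z => if z ∈ insert y T then 0 else 1)).re else 0) else 0)
          else 0)

/-- The void tail (statement of `stub_voidTail`). -/
abbrev stub_voidTail : Prop :=
  ∃ C₁ c₁ : ℝ, 0 < c₁ ∧ ∀ (L : ℕ) [NeZero L], 2 ≤ L → ∀ N : ℕ, 2 ≤ N → 2 * N ≤ L ^ 3 →
    ∀ ψ : TensorIndex (TorusSite 3 L) 2 → ℂ,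
      ψ ∈ spinZSector 1 ((N : ℝ) - (L : ℝ) ^ 3 / 2) → ψ ≠ 0 →
      (xyTorus 3 L 1).mulVec ψ =
        ((lowestEnergyInSector 1 (xyTorus 3 L 1) ((N : ℝ) - (L : ℝ) ^ 3 / 2) : ℝ) : ℂ) • ψ →
      (∀ σ, 0 ≤ (ψ σ).re ∧ (ψ σ).im = 0) → ∀ R : ℕ,
      (∑ T ∈ (Finset.univ : Finset (TorusSite 3 L)).powersetCard (N - 2), ∑ x : TorusSite 3 L,
          if R < ((T.image fun t => (torusGraph 3 L).dist x t).min.untopD 0) then field ψ T x ^ 2 else 0)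
        ≤ C₁ * Real.exp (-(c₁ * ((N : ℝ) / (L : ℝ) ^ 3) * (R : ℝ) ^ 3)) *
          ∑ T ∈ (Finset.univ : Finset (TorusSite 3 L)).powersetCard (N - 2), ∑ x : TorusSite 3 L,
            field ψ T x ^ 2

/-- The annealed gain (conclusion of `stub_annealedGain`). -/
abbrev AnnealedGain' : Prop :=
  ∃ C₂ c₂ : ℝ, ∀ (L : ℕ) [NeZero L], 2 ≤ L → ∀ N : ℕ, 2 ≤ N → 2 * N ≤ L ^ 3 →
    ∀ ψ : TensorIndex (TorusSite 3 L) 2 → ℂ,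
      ψ ∈ spinZSector 1 ((N : ℝ) - (L : ℝ) ^ 3 / 2) → ψ ≠ 0 →
      (xyTorus 3 L 1).mulVec ψ =
        ((lowestEnergyInSector 1 (xyTorus 3 L 1) ((N : ℝ) - (L : ℝ) ^ 3 / 2) : ℝ) : ℂ) • ψ →
      (∀ σ, 0 ≤ (ψ σ).re ∧ (ψ σ).im = 0) → ∀ R : ℕ,
      (∑ T ∈ (Finset.univ : Finset (TorusSite 3 L)).powersetCard (N - 2), ∑ x : TorusSite 3 L,
          if ((T.image fun t => (torusGraph 3 L).dist x t).min.untopD 0) = R then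
            field ψ T x ^ 2 * ((L : ℝ) ^ 3 * field ψ T x / ∑ y : TorusSite 3 L, field ψ T y)
          else 0)
        ≤ C₂ * Real.exp (c₂ * ((N : ℝ) / (L : ℝ) ^ 3) * (R : ℝ) ^ 2) *
          ∑ T ∈ (Finset.univ : Finset (TorusSite 3 L)).powersetCard (N - 2), ∑ x : TorusSite 3 L,
            if ((T.image fun t => (torusGraph 3 L).dist x t).min.untopD 0) = R then field ψ T x ^ 2 else 0

/-- Statement of `stub_annealedGain`. -/
abbrev stub_annealedGain : Prop := stub_embedding → ExcessBound' → AnnealedGain'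

/-- The size-biased third-moment form of the crux (conclusion of `stub_transfer`). -/
abbrev ThirdMomentBound' : Prop :=
  ∃ M' : ℝ, ∀ (L : ℕ) [NeZero L], 2 ≤ L → ∀ N : ℕ, 2 ≤ N → 2 * N ≤ L ^ 3 →
    ∀ ψ : TensorIndex (TorusSite 3 L) 2 → ℂ,
      ψ ∈ spinZSector 1 ((N : ℝ) - (L : ℝ) ^ 3 / 2) → ψ ≠ 0 →
      (xyTorus 3 L 1).mulVec ψ =
        ((lowestEnergyInSector 1 (xyTorus 3 L 1) ((N : ℝ) - (L : ℝ) ^ 3 / 2) : ℝ) : ℂ) • ψ →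
      (∀ σ, 0 ≤ (ψ σ).re ∧ (ψ σ).im = 0) →
      (L : ℝ) ^ 3 * ∑ T ∈ (Finset.univ : Finset (TorusSite 3 L)).powersetCard (N - 2),
          (∑ x, field ψ T x ^ 3) / (∑ x, field ψ T x)
        ≤ M' * ∑ T ∈ (Finset.univ : Finset (TorusSite 3 L)).powersetCard (N - 2), K1rhs (field ψ T)

/-- Statement of `stub_transfer`. -/
abbrev stub_transfer : Prop := stub_voidTail → AnnealedGain' → ThirdMomentBound'

end Registered

/-! ## Proved glue -/

/-- **Cauchy–Schwarz reduction of the crux functional**: for `r ≥ 0`, `K1lhs r ≤ 2·Σr³/Σr` (both sides `0` when `Σr = 0`). -/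
theorem K1lhs_le_two_mul_M3 {ι : Type*} [Fintype ι] (r : ι → ℝ) (hr : ∀ i, 0 ≤ r i) :
    K1lhs r ≤ 2 * ((∑ x, r x ^ 3) / ∑ x, r x) := by
  unfold K1lhs
  have hcs := sq_sum_sq_le_sum_mul_sum_cube r hr
  by_cases h0 : ∑ i, r i = 0
  · simp [h0]
  · have hpos : 0 < ∑ i, r i :=
      lt_of_le_of_ne (Finset.sum_nonneg fun i _ => hr i) (Ne.symm h0)
    have hkey : (∑ i, r i ^ 2) ^ 2 / (∑ i, r i) ^ 2 ≤ (∑ i, r i ^ 3) / ∑ i, r i := by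
      rw [div_le_div_iff₀ (by positivity) hpos]
      calc (∑ i, r i ^ 2) ^ 2 * ∑ i, r i ≤ ((∑ i, r i) * ∑ i, r i ^ 3) * ∑ i, r i :=
            mul_le_mul_of_nonneg_right hcs hpos.le
        _ = (∑ i, r i ^ 3) * (∑ i, r i) ^ 2 := by ring
    linarith

/-- **The third-moment form implies the crux at constant `2M'`.** -/
theorem insertionFieldDelocalisationAt_of_thirdMomentBound (h : Registered.ThirdMomentBound') :
    ∃ M : ℝ, InsertionFieldDelocalisationAt M := by
  obtain ⟨M', hM'⟩ := h
  refine ⟨2 * M', ?_⟩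
  intro L _ hL N hN hNL ψ hψ hne heig hnn
  have key := hM' L hL N hN hNL ψ hψ hne heig hnn
  have hnn' : ∀ σ, 0 ≤ (ψ σ).re := fun σ => (hnn σ).1
  have hsum : ∑ T ∈ (Finset.univ : Finset (TorusSite 3 L)).powersetCard (N - 2), K1lhs (field ψ T)
      ≤ 2 * ∑ T ∈ (Finset.univ : Finset (TorusSite 3 L)).powersetCard (N - 2),
          (∑ x, field ψ T x ^ 3) / (∑ x, field ψ T x) := by
    rw [Finset.mul_sum]
    exact Finset.sum_le_sum fun T _ => K1lhs_le_two_mul_M3 _ (field_nonneg ψ hnn' T)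
  have hL0 : (0 : ℝ) ≤ (L : ℝ) ^ 3 := by positivity
  have hmul := mul_le_mul_of_nonneg_left hsum hL0
  unfold K1Ineq
  linarith

/-! ## The composition: the six stubs imply the crux, by name -/

/-- **`InsertionFieldDelocalisation` from the six def-free stubs** (no `sorry`): convexity feeds the excess bound; embedding and
the excess bound feed the annealed gain; void tail and annealed gain feed the transfer, whose third-moment output is converted into
the crux with `M = 2M'` by the Cauchy–Schwarz reduction and `insertionFieldDelocalisation_iff`. -/
theorem InsertionFieldDelocalisation_of (h1 : Registered.stub_convexity)
    (h2 : Registered.stub_excessBound) (h3 : Registered.stub_embedding)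
    (h4 : Registered.stub_voidTail) (h5 : Registered.stub_annealedGain)
    (h6 : Registered.stub_transfer) : InsertionFieldDelocalisation :=
  insertionFieldDelocalisation_iff.mpr (insertionFieldDelocalisationAt_of_thirdMomentBound (h6 h4 (h5 h3 (h2 h1))))

/-- Wiring check: the registered stubs feed `InsertionFieldDelocalisation_of` as stated. -/
example : InsertionFieldDelocalisation :=
  InsertionFieldDelocalisation_of stub_convexity stub_excessBound stub_embedding stub_voidTail
    stub_annealedGain stub_transfer

end Summit.AtomisticToContinuum.BoseEinsteinCondensation.Cruxes.InsertionFieldDelocalisation.MobileTrapDirichletEigenfunction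

end
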